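import Mathlib
import Literature.NumberTheory.LFunctions.Zhang2022.Section7dPartCClosure
import Literature.NumberTheory.LFunctions.Zhang2022.Section7KappaBounds
import Literature.NumberTheory.LFunctions.Zhang2022.Section7ZetaLowerBound
import HarnessLib

/-!
# Zhang (2022), §7 part (c), node `Z22:§7.u049`: the "standard estimates" bound for the shifted
# contour of (7.19) in its derivable `G₀`-weighted form (`ContourW[G₀]`, gap row G-d24-1), and the
# closure of (7.10)

Topic `Literature/NumberTheory/LFunctions/Zhang2022` (Landau–Siegel audit tree; verdict-neutral).
Y. Zhang, *Discrete mean estimates and the Landau–Siegel zero*, arXiv:2211.02515v1 (2022)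
[Zhang2022LandauSiegel] — **an unrefereed manuscript under adjudication** (cell siegel-zhang,
D-0069). §7 p. 40 (tex L2108–L2121) moves the line of integration of (7.19) to the contour `𝒞`
made of `σ = 1 + α` (`|t| ≥ D`), `σ = 1 − 𝓛⁻¹` (`|t| ≤ D`) and the horizontal segments `σ ± iD`,
and asserts "by Lemma 5.2 (i) and standard estimates" that the integral over `𝒞` is
`O(pkε₁/l₂)`, `ε₁ = exp(−c𝓛^{1/10})` (node `Z22:§7.u049`). The printed UNIFORM constant does not
follow from the manuscript's own bound `|κ̃(d₁;d₂k,s)| ≤ τ₅(d₁)∏(1 + c/q^σ)` (gap row G-d24-1,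
class printed-false-pointwise / harmless); what follows — and what (7.20)/(7.10) actually need,
the weight having a polylogarithmic average (`Section7WeightSummability.weightSum_tauFive_le`) — is
the bound with the weight `G₀(D,d₁,d₂,k) = τ₅(d₁)∏_{q∣d₁d₂k}(1 + 200q^{−9/10})²`. THEOREM-ONLY file
(0 new definitions, 0 new facts):

* `contourBoundG0` — **`ContourW[G₀]`**, VERBATIM the hypothesis `hbound` of
  `Section7dStatements.eq710_of_contourBoundG0` (`Section7dPartCClosure`): under (A), `D` large,
  `p ∼ P`, `d₂l₂ < PT⁻²`, `d₁d₂k < PT⁻²`: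
  `‖(1/2πi)∫_𝒞 (l₂/pk)^{−s}κ̃λ·ζ(s+β₁)ζ(s+β₂)ζ(s+β₃)ζ(s)⁻¹δ(s) ds‖ ≤ C·G₀·pk·ε₁/l₂` (`c = 1/2`,
  `C = 1`). Inputs, all tree theorems: `Z22:§7.u046` (`KappaBounds.norm_kappaTilde_le`,
  `norm_lam_le`), Lemma 5.4 (i) (`Skeleton.lemma54_holds`: `δ(s) ≪ 𝓛ᵏ|s|⁻²`), Titchmarsh's
  Theorem 3.5 (`ZetaNearOne.norm_riemannZeta_le_exp_mul_log`), the pole of `ζ` (`ZetaNearOne.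
  exists_bound_riemannZeta_rect`), `ζ, ζ⁻¹ ≤ 1 + 1/δ` on `σ ≥ 1 + δ`, and — the one input the print
  leaves implicit — `ζ(s)⁻¹ ≪ 𝓛⁹` on `1 − 𝓛⁻¹ ≤ σ ≤ 1 + 𝓛⁻¹`, `|t| ≤ D` under (A)
  (`ZetaLowerBound.norm_inv_zeta_le_pow_nine`, Deuring–Heilbronn + Borel–Carathéodory). The
  saving is `(pk/l₂)^{−𝓛⁻¹} ≤ T^{−2/𝓛} = exp(−2𝓛^{1/10})` on the near segment (`pk/l₂ > T²`) and
  `∫_{|t|≥D}t⁻²dt = 2/D`, `D⁻²` on the other pieces; powers of `𝓛` are absorbed by halving the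
  constant of `ε₁` (`Section7dStatements.absorb_pow_log_eps1`).
* `Section7dStatements.eq710_holds : Section7bStatements.Eq710 c′` — **(7.10) HOLDS** (cone leaf
  `h710` of the whole-DAG theorem), by `eq710_of_contourBoundG0`; and
  `Section7dStatements.prop71_of_leaves_ab` — Proposition 7.1 from its part-(a)/(b) leaves
  (7.6), (7.7)′, (7.11) alone.

Node tokens: `Z22:(7.10)` = discharged (`eq710_holds`); `Z22:§7.u049`/`§7.u052`/`(7.20)` =
discharged in the weighted reading of G-d24-1 (edges `step7u049_of_weighted`,
`ded7u052_of_weighted`, `eq720_of_weighted` fed by `contourBoundG0`).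

WHAT THIS IS NOT: any claim about Theorems 1–2 of the manuscript or about Landau–Siegel zeros;
not the printed uniform form of `Z22:§7.u049` (G-d24-1 records why that form does not follow);
CONDITIONAL on (A) exactly as every §§5–18 statement of the manuscript.

## References

* Y. Zhang, arXiv:2211.02515v1 (2022), §7 pp. 39–42, tex L2093–L2138; (7.10) p. 37 tex L1973;
  §5 Lemma 5.4; §2 (2.1), (2.6), (2.10), (2.13). [cite: Zhang2022LandauSiegel, §7 p.40]
* E. C. Titchmarsh, *The Theory of the Riemann Zeta-Function*, 2nd ed. (1986), Thm. 3.5, §2.1.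
  [cite: Titchmarsh1986, Thm. 3.5]
-/

noncomputable section

open Complex Real MeasureTheory Set Filter

namespace Literature.NumberTheory.LFunctions.Zhang2022.ContourBound7

/-! ### §0. Largeness of `D` and the parameters `𝓛, α, P, T, β_j` -/

/-- For every `L₀` there is `D₀` with `𝓛 = log D ≥ max(L₀, 4)` for all `D ≥ D₀`. [folklore] -/
private theorem exists_nat_ell_ge (L₀ : ℝ) :
    ∃ D₀ : ℕ, ∀ D : ℕ, D₀ ≤ D → L₀ ≤ Skeleton.ell D ∧ 4 ≤ Skeleton.ell D := by
  refine ⟨⌈Real.exp (max L₀ 4)⌉₊, fun D hD => ?_⟩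
  unfold Skeleton.ell
  have h1 : Real.exp (max L₀ 4) ≤ D := (Nat.le_ceil _).trans (by exact_mod_cast hD)
  have h2 := Real.log_le_log (Real.exp_pos _) h1
  rw [Real.log_exp] at h2
  exact ⟨(le_max_left _ _).trans h2, (le_max_right _ _).trans h2⟩

/-- From `𝓛 ≥ 4`: `D ≥ 3`, `D = e^𝓛`, `0 < α ≤ 𝓛⁻¹ ≤ 1/4`, `α·log P = π`, `1 + 1/α ≤ 𝓛⁹`.
[cite: Zhang2022LandauSiegel, §2 (2.1), (2.6), (2.10)] -/
private theorem param_facts {D : ℕ} (hℓ4 : 4 ≤ Skeleton.ell D) :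
    (3 : ℝ) ≤ D ∧ (D : ℝ) = Real.exp (Skeleton.ell D) ∧ 0 < Skeleton.alpha D ∧
      Skeleton.alpha D ≤ (Skeleton.ell D)⁻¹ ∧ (Skeleton.ell D)⁻¹ ≤ 1 / 4 ∧
      Skeleton.alpha D * Real.log (Skeleton.bigP D) = π ∧
      Real.log (Skeleton.bigP D) = Skeleton.ell D ^ 9 ∧
      1 + 1 / Skeleton.alpha D ≤ Skeleton.ell D ^ 9 := by
  set ℓ := Skeleton.ell D with hℓdef
  have hℓ0 : 0 < ℓ := by linarith
  have hD0 : (0 : ℝ) < D := by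
    by_contra h
    push Not at h
    have hD0' : (D : ℝ) = 0 := le_antisymm h (Nat.cast_nonneg D)
    have : ℓ = 0 := by rw [hℓdef, Skeleton.ell, hD0', Real.log_zero]
    linarith
  have hDexp : (D : ℝ) = Real.exp ℓ := by rw [hℓdef, Skeleton.ell, Real.exp_log hD0]
  have hD3 : (3 : ℝ) ≤ D := by
    rw [hDexp]
    have h4 : Real.exp 4 ≤ Real.exp ℓ := Real.exp_le_exp.mpr hℓ4
    have he : (3 : ℝ) ≤ Real.exp 4 := by
      have := Real.add_one_le_exp (4 : ℝ); linarith
    linarith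
  have hlogP : Real.log (Skeleton.bigP D) = ℓ ^ 9 := by rw [Skeleton.bigP, Real.log_exp]
  have hα : Skeleton.alpha D = π / ℓ ^ 9 := by rw [Skeleton.alpha, hlogP]
  have hℓ9 : 0 < ℓ ^ 9 := by positivity
  have hαpos : 0 < Skeleton.alpha D := by rw [hα]; positivity
  have hαℓ : Skeleton.alpha D ≤ ℓ⁻¹ := by
    rw [hα, div_le_iff₀ hℓ9]
    have h8 : (4 : ℝ) ^ 8 ≤ ℓ ^ 8 := by gcongr
    calc π ≤ 4 := Real.pi_lt_four.le
      _ ≤ ℓ⁻¹ * ℓ ^ 9 := by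
          rw [show ℓ⁻¹ * ℓ ^ 9 = ℓ ^ 8 by field_simp]
          nlinarith [h8]
  have hℓinv : ℓ⁻¹ ≤ 1 / 4 := by
    rw [inv_eq_one_div]; exact one_div_le_one_div_of_le (by norm_num) hℓ4
  have hαlogP : Skeleton.alpha D * Real.log (Skeleton.bigP D) = π := by
    rw [hα, hlogP]; field_simp
  have hinvα : 1 + 1 / Skeleton.alpha D ≤ ℓ ^ 9 := by
    rw [hα, one_div_div]
    have h9 : (4 : ℝ) ^ 9 ≤ ℓ ^ 9 := by gcongr
    have h3 : ℓ ^ 9 / π ≤ ℓ ^ 9 / 3 :=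
      div_le_div_of_nonneg_left hℓ9.le (by norm_num) Real.pi_gt_three.le
    nlinarith [h9, h3]
  exact ⟨hD3, hDexp, hαpos, hαℓ, hℓinv, hαlogP, hlogP, hinvα⟩

/-- The shifts are purely imaginary. [cite: Zhang2022LandauSiegel, §2 (2.13)] -/
private theorem beta_re (c' : ℝ) (D : ℕ) :
    (Skeleton.beta1 c' D).re = 0 ∧ (Skeleton.beta2 c' D).re = 0 ∧ (Skeleton.beta3 c' D).re = 0 := by
  simp [Skeleton.beta1, Skeleton.beta2, Skeleton.beta3]

/-- For `𝓛 ≥ 12 + 80|c′|` (and `𝓛 ≥ 4`) the shifts satisfy `|Im β_j| ≤ 1`.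
[cite: Zhang2022LandauSiegel, §2 (2.13)] -/
private theorem beta_im_le (c' : ℝ) {D : ℕ} (hℓ4 : 4 ≤ Skeleton.ell D)
    (hℓc : 12 + 80 * |c'| ≤ Skeleton.ell D) :
    |(Skeleton.beta1 c' D).im| ≤ 1 ∧ |(Skeleton.beta2 c' D).im| ≤ 1 ∧
      |(Skeleton.beta3 c' D).im| ≤ 1 := by
  obtain ⟨-, -, hαpos, hαℓ, hℓinv, -, hlogP, -⟩ := param_facts hℓ4
  set ℓ := Skeleton.ell D with hℓdef
  set α := Skeleton.alpha D with hαdef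
  have hℓ0 : 0 < ℓ := by linarith
  have hℓ1 : 1 ≤ ℓ := by linarith
  -- `α ≤ ℓ⁻¹` and `αℓ ≤ 1`, hence `|c′|αℓ ≤ |c′|` and `α(1 + n|c′|αℓ) ≤ ℓ⁻¹(1 + n|c′|)`
  have hαℓ1 : α * ℓ ≤ 1 := by
    calc α * ℓ ≤ ℓ⁻¹ * ℓ := by gcongr
      _ = 1 := inv_mul_cancel₀ hℓ0.ne'
  have hcαℓ : |c'| * (α * ℓ) ≤ |c'| := by
    calc |c'| * (α * ℓ) ≤ |c'| * 1 := by gcongr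
      _ = |c'| := mul_one _
  have h1 : (Skeleton.beta1 c' D).im = α * (1 - 5 * c' * α * ℓ) := by simp [Skeleton.beta1, hαdef, hℓdef]
  have h2 : (Skeleton.beta2 c' D).im = 2 * α * (1 + c' * α * ℓ) := by simp [Skeleton.beta2, hαdef, hℓdef]
  have h3 : (Skeleton.beta3 c' D).im = 3 * α * (1 - c' * α * ℓ) := by simp [Skeleton.beta3, hαdef, hℓdef]
  have key : ∀ (n e : ℝ), 0 ≤ n → n ≤ 3 → |e| ≤ 5 →
      |n * α * (1 + e * (c' * α * ℓ))| ≤ 1 := by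
    intro n e hn0 hn3 he
    rw [abs_mul, abs_mul, abs_of_nonneg hn0, abs_of_pos hαpos]
    have hin : |1 + e * (c' * α * ℓ)| ≤ 1 + 5 * |c'| := by
      calc |1 + e * (c' * α * ℓ)| ≤ |1| + |e * (c' * α * ℓ)| := abs_add_le _ _
        _ = 1 + |e| * (|c'| * (α * ℓ)) := by
            rw [abs_one, abs_mul, abs_mul, abs_mul, abs_of_pos hαpos, abs_of_pos hℓ0]; ring
        _ ≤ 1 + 5 * |c'| := by
            have : |e| * (|c'| * (α * ℓ)) ≤ 5 * |c'| :=
              mul_le_mul he hcαℓ (by positivity) (by norm_num)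
            linarith
    calc n * α * |1 + e * (c' * α * ℓ)| ≤ 3 * ℓ⁻¹ * (1 + 5 * |c'|) := by
          gcongr
      _ = (3 + 15 * |c'|) / ℓ := by field_simp; ring
      _ ≤ 1 := by
          rw [div_le_one hℓ0]; linarith [abs_nonneg c']
  refine ⟨?_, ?_, ?_⟩
  · rw [h1]
    have := key 1 (-5) (by norm_num) (by norm_num) (by norm_num)
    convert this using 2; ring
  · rw [h2]
    have := key 2 1 (by norm_num) (by norm_num) (by norm_num)
    convert this using 2; ring
  · rw [h3]
    have := key 3 (-1) (by norm_num) (by norm_num) (by norm_num)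
    convert this using 2; ring

/-! ### §1. The weight `G₀` and the pointwise size of the integrand -/

/-- For `σ ≥ 9/10` and `S ⊆` the prime factors of `n`:
`∏_{q∈S} |1 + 200/q^σ| ≤ ∏_{q∣n} (1 + 200/q^{9/10})`. [cite: Zhang2022LandauSiegel, §7 p.40, tex L2105] -/
private theorem prod_abs_le_prod {n : ℕ} {S : Finset ℕ} (hS : S ⊆ n.primeFactors) {σ : ℝ}
    (hσ : 9 / 10 ≤ σ) :
    ∏ q ∈ S, |1 + 200 / (q : ℝ) ^ σ| ≤ ∏ q ∈ n.primeFactors, (1 + 200 / (q : ℝ) ^ (9 / 10 : ℝ)) := by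
  have hfac : ∀ q ∈ n.primeFactors, (1 : ℝ) ≤ q := fun q hq => by
    exact_mod_cast (Nat.prime_of_mem_primeFactors hq).one_lt.le
  calc ∏ q ∈ S, |1 + 200 / (q : ℝ) ^ σ| ≤ ∏ q ∈ S, (1 + 200 / (q : ℝ) ^ (9 / 10 : ℝ)) := by
        refine Finset.prod_le_prod (fun q _ => abs_nonneg _) fun q hq => ?_
        have hq1 := hfac q (hS hq)
        have hqσ : (q : ℝ) ^ (9 / 10 : ℝ) ≤ (q : ℝ) ^ σ := Real.rpow_le_rpow_of_exponent_le hq1 hσ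
        have hq9 : 0 < (q : ℝ) ^ (9 / 10 : ℝ) := by positivity
        have hpos : 0 < 1 + 200 / (q : ℝ) ^ σ := by positivity
        rw [abs_of_pos hpos]
        have := div_le_div_of_nonneg_left (by norm_num : (0 : ℝ) ≤ 200) hq9 hqσ
        linarith
    _ ≤ ∏ q ∈ n.primeFactors, (1 + 200 / (q : ℝ) ^ (9 / 10 : ℝ)) := by
        rw [← Finset.prod_sdiff hS]
        have h1 : (1 : ℝ) ≤ ∏ q ∈ n.primeFactors \ S, (1 + 200 / (q : ℝ) ^ (9 / 10 : ℝ)) := by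
          calc (1 : ℝ) = ∏ _q ∈ n.primeFactors \ S, (1 : ℝ) := Finset.prod_const_one.symm
            _ ≤ _ := Finset.prod_le_prod (fun _ _ => zero_le_one) fun q _ => by
                have : 0 ≤ 200 / (q : ℝ) ^ (9 / 10 : ℝ) := by positivity
                linarith
        have h0 : 0 ≤ ∏ q ∈ S, (1 + 200 / (q : ℝ) ^ (9 / 10 : ℝ)) :=
          Finset.prod_nonneg fun q _ => by positivity
        exact le_mul_of_one_le_left h0 h1

/-- The norm of `ζ(s+β₁)ζ(s+β₂)ζ(s+β₃)/ζ(s)`. [cite: Zhang2022LandauSiegel, §7 p.40, tex L2102] -/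
private theorem norm_zetaRatio (c' : ℝ) (D : ℕ) (s : ℂ) :
    ‖Section7dStatements.zetaRatio c' D s‖ =
      ‖riemannZeta (s + Skeleton.beta1 c' D)‖ * ‖riemannZeta (s + Skeleton.beta2 c' D)‖ *
        ‖riemannZeta (s + Skeleton.beta3 c' D)‖ * ‖(riemannZeta s)⁻¹‖ := by
  rw [Section7dStatements.zetaRatio, div_eq_mul_inv, norm_mul, norm_mul, norm_mul]

/-- **Pointwise size of the integrand.** With `x = X⁻¹`, `σ = Re s > 9/10` and bounds `Bx, Z, Zi, Bδ`
for `X^σ`, the three `ζ(s+β_j)`, `ζ(s)⁻¹` and `δ(s)`: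
`‖x^{−s}κ̃(d₁;m,s)λ(n,s)ζζζζ⁻¹δ‖ ≤ Bx·G₀·Z³·Zi·Bδ`, `G₀ = τ₅(d₁)∏_{q∣n}(1 + 200q^{−9/10})²` (`d₁ ∣ n`),
by `Z22:§7.u046` (`KappaBounds.norm_kappaTilde_le`, `norm_lam_le`).
[cite: Zhang2022LandauSiegel, §7 p.40, tex L2105–L2121] -/
private theorem norm_integrand_le (c' : ℝ) (D : ℕ) {d₁ m n : ℕ} (hd₁ : d₁ ≠ 0) (hdn : d₁ ∣ n)
    (hn : n ≠ 0) {x X : ℝ} (hX : 0 < X) (hxX : x = X⁻¹) {s : ℂ} (hσ : 9 / 10 < s.re)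
    {Bx Z Zi Bδ : ℝ} (hZ0 : 0 ≤ Z) (hBx : X ^ s.re ≤ Bx)
    (hZ1 : ‖riemannZeta (s + Skeleton.beta1 c' D)‖ ≤ Z)
    (hZ2 : ‖riemannZeta (s + Skeleton.beta2 c' D)‖ ≤ Z)
    (hZ3 : ‖riemannZeta (s + Skeleton.beta3 c' D)‖ ≤ Z)
    (hZi : ‖(riemannZeta s)⁻¹‖ ≤ Zi) (hδ : ‖Skeleton.deltaW D s‖ ≤ Bδ) :
    ‖((x : ℝ) : ℂ) ^ (-s) *
        (Skeleton.kappaTilde c' D d₁ m s * Skeleton.lam c' D n s * Section7dStatements.resFn c' D s)‖ ≤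
      Bx * ((Section7dStatements.tauFive d₁ : ℝ) *
        ∏ q ∈ n.primeFactors, (1 + 200 / (q : ℝ) ^ (9 / 10 : ℝ)) ^ 2) * (Z ^ 3 * Zi * Bδ) := by
  have hx : 0 < x := by rw [hxX]; positivity
  set Pr : ℝ := ∏ q ∈ n.primeFactors, (1 + 200 / (q : ℝ) ^ (9 / 10 : ℝ)) with hPr
  have hPr0 : 0 ≤ Pr := Finset.prod_nonneg fun q _ => by positivity
  -- `‖x^{−s}‖ = X^σ`
  have h_x : ‖((x : ℝ) : ℂ) ^ (-s)‖ = X ^ s.re := by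
    rw [Complex.norm_cpow_eq_rpow_re_of_pos hx, Complex.neg_re, hxX, Real.inv_rpow hX.le,
      Real.rpow_neg hX.le, inv_inv]
  -- `κ̃`, `λ`
  have h_κ : ‖Skeleton.kappaTilde c' D d₁ m s‖ ≤ Section7dStatements.tauFive d₁ * Pr := by
    refine (KappaBounds.norm_kappaTilde_le c' D hd₁ m hσ).trans ?_
    exact mul_le_mul_of_nonneg_left
      (prod_abs_le_prod (Nat.primeFactors_mono hdn hn) hσ.le) (Nat.cast_nonneg _)
  have h_lam : ‖Skeleton.lam c' D n s‖ ≤ Pr :=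
    (KappaBounds.norm_lam_le c' D n hσ).trans (prod_abs_le_prod (subset_refl _) hσ.le)
  -- `resFn`
  have h_res : ‖Section7dStatements.resFn c' D s‖ ≤ Z ^ 3 * Zi * Bδ := by
    rw [Section7dStatements.resFn, norm_mul, norm_zetaRatio]
    have hZi0 : 0 ≤ Zi := (norm_nonneg _).trans hZi
    calc ‖riemannZeta (s + Skeleton.beta1 c' D)‖ * ‖riemannZeta (s + Skeleton.beta2 c' D)‖ *
          ‖riemannZeta (s + Skeleton.beta3 c' D)‖ * ‖(riemannZeta s)⁻¹‖ * ‖Skeleton.deltaW D s‖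
        ≤ Z * Z * Z * Zi * Bδ := by gcongr
      _ = Z ^ 3 * Zi * Bδ := by ring
  have hBx0 : 0 ≤ Bx := le_trans (by positivity) hBx
  have hres0 : 0 ≤ Z ^ 3 * Zi * Bδ := (norm_nonneg _).trans h_res
  rw [norm_mul, norm_mul, norm_mul, h_x]
  calc X ^ s.re * (‖Skeleton.kappaTilde c' D d₁ m s‖ * ‖Skeleton.lam c' D n s‖ *
        ‖Section7dStatements.resFn c' D s‖)
      ≤ Bx * ((Section7dStatements.tauFive d₁ * Pr) * Pr * (Z ^ 3 * Zi * Bδ)) := by gcongr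
    _ = Bx * ((Section7dStatements.tauFive d₁ : ℝ) *
        ∏ q ∈ n.primeFactors, (1 + 200 / (q : ℝ) ^ (9 / 10 : ℝ)) ^ 2) * (Z ^ 3 * Zi * Bδ) := by
        rw [Finset.prod_pow, hPr]; ring


/-! ### §2. The `ζ`-inputs on the contour -/

/-- `ζ` in the logarithmic region: `Re w ≥ 1 − 𝓛⁻¹`, `3 ≤ |Im w| ≤ 2D` ⇒ `‖ζ(w)‖ ≤ 16e²𝓛`
(Titchmarsh 3.5 with `A = 2`, `ZetaNearOne.norm_riemannZeta_le_exp_mul_log`).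
[cite: Zhang2022LandauSiegel, §7 p.40, tex L2118–L2121] -/
private theorem norm_zeta_le_log_region {w : ℂ} {ℓ : ℝ} {D : ℕ} (hℓ4 : 4 ≤ ℓ)
    (hℓD : (D : ℝ) = Real.exp ℓ) (hre : 1 - ℓ⁻¹ ≤ w.re) (him3 : 3 ≤ |w.im|)
    (himD : |w.im| ≤ 2 * D) : ‖riemannZeta w‖ ≤ 16 * Real.exp 2 * ℓ := by
  have hℓ0 : 0 < ℓ := by linarith
  have hℓinv : ℓ⁻¹ ≤ 1 / 4 := by
    rw [inv_eq_one_div]; exact one_div_le_one_div_of_le (by norm_num) hℓ4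
  have hlog0 : 0 < Real.log |w.im| := Real.log_pos (by linarith)
  have hlog : Real.log |w.im| ≤ 2 * ℓ := by
    calc Real.log |w.im| ≤ Real.log (2 * D) := Real.log_le_log (by linarith) himD
      _ = Real.log 2 + ℓ := by
          rw [Real.log_mul (by norm_num) (by rw [hℓD]; exact (Real.exp_pos _).ne'), hℓD,
            Real.log_exp]
      _ ≤ 2 * ℓ := by linarith [Real.log_two_lt_d9]
  have hdepth : 1 - 2 / Real.log |w.im| ≤ w.re := by
    have : ℓ⁻¹ ≤ 2 / Real.log |w.im| := by
      rw [inv_eq_one_div, div_le_div_iff₀ hℓ0 hlog0]; linarith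
    linarith
  have h := ZetaNearOne.norm_riemannZeta_le_exp_mul_log (s := w) (A := 2) (by norm_num) him3
    (by linarith) hdepth
  calc ‖riemannZeta w‖ ≤ 8 * Real.exp 2 * Real.log |w.im| := h
    _ ≤ 8 * Real.exp 2 * (2 * ℓ) := by gcongr
    _ = 16 * Real.exp 2 * ℓ := by ring

/-- `ζ` next to the pole on the line `Re w = 1 − 𝓛⁻¹`: `|Im w| < 3` ⇒ `‖ζ(w)‖ ≤ M + 𝓛` with the
rectangle bound `M` of `ZetaNearOne.exists_bound_riemannZeta_rect`. [cite: Titchmarsh1986, §2.1] -/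
private theorem norm_zeta_le_near_pole {w : ℂ} {ℓ M : ℝ} (hℓ4 : 4 ≤ ℓ)
    (hM : ∀ s : ℂ, 1 / 2 ≤ s.re → s.re ≤ 2 → |s.im| ≤ 3 → s ≠ 1 →
      ‖riemannZeta s‖ ≤ M + 1 / ‖s - 1‖)
    (hre : w.re = 1 - ℓ⁻¹) (him : |w.im| < 3) : ‖riemannZeta w‖ ≤ M + ℓ := by
  have hℓ0 : 0 < ℓ := by linarith
  have hℓinv0 : 0 < ℓ⁻¹ := inv_pos.mpr hℓ0
  have hℓinv : ℓ⁻¹ ≤ 1 / 4 := by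
    rw [inv_eq_one_div]; exact one_div_le_one_div_of_le (by norm_num) hℓ4
  have hw1 : w ≠ 1 := fun h => by
    have := congrArg Complex.re h; rw [hre, Complex.one_re] at this; linarith
  have h := hM w (by rw [hre]; linarith) (by rw [hre]; linarith) him.le hw1
  have hdist : ℓ⁻¹ ≤ ‖w - 1‖ := by
    have := abs_re_le_norm (w - 1)
    rw [Complex.sub_re, hre, Complex.one_re, show 1 - ℓ⁻¹ - 1 = -ℓ⁻¹ by ring, abs_neg,
      abs_of_pos hℓinv0] at this
    exact this
  have hinv : 1 / ‖w - 1‖ ≤ ℓ := by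
    rw [one_div]
    calc ‖w - 1‖⁻¹ ≤ (ℓ⁻¹)⁻¹ := inv_anti₀ hℓinv0 hdist
      _ = ℓ := inv_inv ℓ
  linarith

/-- **The shifted `ζ`-factors on the near vertical segment**: `s = 1 − 𝓛⁻¹ + it`, `|t| ≤ D`,
`Re β = 0`, `|Im β| ≤ 1` ⇒ `‖ζ(s+β)‖ ≤ (16e² + M + 1)𝓛`. [cite: Zhang2022LandauSiegel, §7 p.40] -/
private theorem norm_zeta_shift_le_near {s β : ℂ} {ℓ M : ℝ} {D : ℕ} (hℓ4 : 4 ≤ ℓ)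
    (hℓD : (D : ℝ) = Real.exp ℓ) (hM0 : 0 ≤ M)
    (hM : ∀ s : ℂ, 1 / 2 ≤ s.re → s.re ≤ 2 → |s.im| ≤ 3 → s ≠ 1 →
      ‖riemannZeta s‖ ≤ M + 1 / ‖s - 1‖)
    (hre : s.re = 1 - ℓ⁻¹) (him : |s.im| ≤ D) (hβre : β.re = 0) (hβim : |β.im| ≤ 1) :
    ‖riemannZeta (s + β)‖ ≤ (16 * Real.exp 2 + M + 1) * ℓ := by
  have hℓ1 : 1 ≤ ℓ := by linarith
  have hD3 : (3 : ℝ) ≤ D := by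
    rw [hℓD]
    have := Real.add_one_le_exp ℓ; linarith
  have hwre : (s + β).re = 1 - ℓ⁻¹ := by rw [Complex.add_re, hβre, hre, add_zero]
  have hwim : |(s + β).im| ≤ 2 * D := by
    rw [Complex.add_im]
    calc |s.im + β.im| ≤ |s.im| + |β.im| := abs_add_le _ _
      _ ≤ D + 1 := by linarith
      _ ≤ 2 * D := by linarith
  have hE : 0 ≤ 16 * Real.exp 2 := by positivity
  rcases le_or_gt 3 |(s + β).im| with h3 | h3
  · have h := norm_zeta_le_log_region hℓ4 hℓD hwre.ge h3 hwim
    calc ‖riemannZeta (s + β)‖ ≤ 16 * Real.exp 2 * ℓ := h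
      _ ≤ (16 * Real.exp 2 + M + 1) * ℓ := by nlinarith
  · have h := norm_zeta_le_near_pole hℓ4 hM hwre h3
    calc ‖riemannZeta (s + β)‖ ≤ M + ℓ := h
      _ ≤ (16 * Real.exp 2 + M + 1) * ℓ := by nlinarith

/-- **The shifted `ζ`-factors on the horizontal segments**: `s = σ ± iD`, `σ ≥ 1 − 𝓛⁻¹`,
`Re β = 0`, `|Im β| ≤ 1` ⇒ `‖ζ(s+β)‖ ≤ 16e²𝓛`. [cite: Zhang2022LandauSiegel, §7 p.40] -/
private theorem norm_zeta_shift_le_horiz {s β : ℂ} {ℓ : ℝ} {D : ℕ} (hℓ4 : 4 ≤ ℓ)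
    (hℓD : (D : ℝ) = Real.exp ℓ) (hre : 1 - ℓ⁻¹ ≤ s.re) (him : |s.im| = D) (hβre : β.re = 0)
    (hβim : |β.im| ≤ 1) : ‖riemannZeta (s + β)‖ ≤ 16 * Real.exp 2 * ℓ := by
  have hD4 : (4 : ℝ) ≤ D := by
    rw [hℓD]
    have := Real.add_one_le_exp ℓ; linarith
  have hwre : 1 - ℓ⁻¹ ≤ (s + β).re := by rw [Complex.add_re, hβre, add_zero]; exact hre
  have hwim : |(s + β).im| ≤ 2 * D := by
    rw [Complex.add_im]
    calc |s.im + β.im| ≤ |s.im| + |β.im| := abs_add_le _ _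
      _ ≤ D + 1 := by rw [him]; linarith
      _ ≤ 2 * D := by linarith
  have hwim3 : 3 ≤ |(s + β).im| := by
    rw [Complex.add_im]
    have := abs_sub_abs_le_abs_sub s.im (-β.im)
    rw [sub_neg_eq_add, abs_neg, him] at this
    linarith
  exact norm_zeta_le_log_region hℓ4 hℓD hwre hwim3 hwim

/-! ### §3. Majorant integrals -/

/-- Tail integral: `‖Φ(t)‖ ≤ K t⁻²` on `t > D > 0` ⇒ `‖∫_{t>D} Φ‖ ≤ K/D`. [folklore] -/
private theorem norm_integral_Ioi_le {Φ : ℝ → ℂ} {K D : ℝ} (hD : 0 < D)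
    (h : ∀ t ∈ Ioi D, ‖Φ t‖ ≤ K * t ^ (-2 : ℝ)) : ‖∫ t in Ioi D, Φ t‖ ≤ K / D := by
  have hint : IntegrableOn (fun t : ℝ => K * t ^ (-2 : ℝ)) (Ioi D) :=
    (integrableOn_Ioi_rpow_of_lt (by norm_num) hD).const_mul K
  calc ‖∫ t in Ioi D, Φ t‖ ≤ ∫ t in Ioi D, K * t ^ (-2 : ℝ) :=
        norm_integral_le_of_norm_le hint (ae_restrict_of_forall_mem measurableSet_Ioi h)
    _ = K * ∫ t in Ioi D, t ^ (-2 : ℝ) := integral_const_mul _ _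
    _ = K / D := by
        rw [integral_Ioi_rpow_of_lt (by norm_num) hD, show (-2 : ℝ) + 1 = -1 by norm_num,
          Real.rpow_neg_one]
        field_simp

/-- Lorentzian majorant: `‖Φ(t)‖ ≤ K(1+t²)⁻¹` on `[a,b]` (`K ≥ 0`) ⇒ `‖∫_{[a,b]} Φ‖ ≤ Kπ`. [folklore] -/
private theorem norm_integral_Icc_le {Φ : ℝ → ℂ} {K a b : ℝ} (hK : 0 ≤ K)
    (h : ∀ t ∈ Icc a b, ‖Φ t‖ ≤ K * (1 + t ^ 2)⁻¹) : ‖∫ t in Icc a b, Φ t‖ ≤ K * π := by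
  have hint : Integrable (fun t : ℝ => K * (1 + t ^ 2)⁻¹) := integrable_inv_one_add_sq.const_mul K
  calc ‖∫ t in Icc a b, Φ t‖ ≤ ∫ t in Icc a b, K * (1 + t ^ 2)⁻¹ :=
        norm_integral_le_of_norm_le hint.integrableOn (ae_restrict_of_forall_mem measurableSet_Icc h)
    _ ≤ ∫ t, K * (1 + t ^ 2)⁻¹ :=
        setIntegral_le_integral hint (Eventually.of_forall fun t => by positivity)
    _ = K * π := by rw [integral_const_mul, integral_univ_inv_one_add_sq]

/-- The normalising constants have norm `≤ 1`: `‖1/(2π)‖ ≤ 1`, `‖1/(2πi)‖ ≤ 1`. [folklore] -/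
private theorem norm_consts_le_one :
    ‖(1 : ℂ) / (2 * (π : ℂ))‖ ≤ 1 ∧ ‖(1 : ℂ) / (2 * (π : ℂ) * I)‖ ≤ 1 := by
  have hπ : ‖(π : ℂ)‖ = π := by rw [Complex.norm_real, Real.norm_of_nonneg Real.pi_pos.le]
  have h2π : (1 : ℝ) ≤ 2 * π := by linarith [Real.pi_gt_three]
  constructor
  · rw [norm_div, norm_one, norm_mul, hπ, Complex.norm_ofNat]
    exact (div_le_one (by positivity)).mpr h2π
  · rw [norm_div, norm_one, norm_mul, norm_mul, hπ, Complex.norm_ofNat, Complex.norm_I, mul_one]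
    exact (div_le_one (by positivity)).mpr h2π

/-! ### §4. The size of `X = pk/l₂` on the ranges of (7.18) -/

/-- `p < 3P` on the window `p ∼ P` (`𝓛 ≥ 1`), and `P < p`. [cite: Zhang2022LandauSiegel, §2 p.4] -/
private theorem primeWindow_bounds {D p : ℕ} (hℓ1 : 1 ≤ Skeleton.ell D)
    (hp : p ∈ Skeleton.primeWindow D) :
    Skeleton.bigP D < p ∧ (p : ℝ) ≤ 3 * Skeleton.bigP D := by
  have hP1 : 1 ≤ Skeleton.bigP D := Real.one_le_exp (by positivity)
  have hℓ : (Skeleton.ell D ^ 68)⁻¹ ≤ 1 := inv_le_one_of_one_le₀ (one_le_pow₀ hℓ1)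
  simp only [Skeleton.primeWindow, Finset.mem_filter, Finset.mem_Ioo] at hp
  have h0 : 0 ≤ Skeleton.bigP D * (1 + (Skeleton.ell D ^ 68)⁻¹) := by positivity
  have h1 : (p : ℝ) < Skeleton.bigP D * (1 + (Skeleton.ell D ^ 68)⁻¹) + 1 :=
    lt_of_le_of_lt (by exact_mod_cast hp.1.2.le) (Nat.ceil_lt_add_one h0)
  refine ⟨?_, by nlinarith [mul_le_mul_of_nonneg_left hℓ (zero_le_one.trans hP1)]⟩
  have h2 : ⌊Skeleton.bigP D⌋₊ + 1 ≤ p := hp.1.1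
  have h3 : Skeleton.bigP D < (⌊Skeleton.bigP D⌋₊ : ℝ) + 1 := Nat.lt_floor_add_one _
  calc Skeleton.bigP D < (⌊Skeleton.bigP D⌋₊ : ℝ) + 1 := h3
    _ ≤ p := by exact_mod_cast h2

/-- **Size of `X = pk/l₂`** on the ranges `d₂l₂ < PT⁻²`, `d₁d₂k < PT⁻²`, `p ∼ P` (`𝓛 ≥ 4`):
`T² < X ≤ P³`; hence `X^{1−𝓛⁻¹} ≤ X·exp(−2𝓛^{1/10})` and `X^σ ≤ e^{3π}X` for `σ ≤ 1 + α`.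
[cite: Zhang2022LandauSiegel, §7 p.40, tex L2097–L2121] -/
private theorem X_facts {D p d₁ d₂ k l₂ : ℕ} (hℓ4 : 4 ≤ Skeleton.ell D)
    (hp : p ∈ Skeleton.primeWindow D) (hd₁ : 0 < d₁) (hd₂ : 0 < d₂) (hk : 0 < k) (hl₂ : 0 < l₂)
    (h1 : ((d₂ * l₂ : ℕ) : ℝ) < Skeleton.bigP D / Skeleton.bigT D ^ 2)
    (h2 : ((d₁ * d₂ * k : ℕ) : ℝ) < Skeleton.bigP D / Skeleton.bigT D ^ 2) :
    let X : ℝ := (p : ℝ) * k / l₂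
    0 < X ∧ 1 ≤ X ∧ (l₂ : ℝ) / ((p : ℝ) * k) = X⁻¹ ∧
      X ^ (1 - (Skeleton.ell D)⁻¹) ≤ X * Real.exp (-(2 * Skeleton.ell D ^ ((1 : ℝ) / 10))) ∧
      ∀ σ : ℝ, σ ≤ 1 + Skeleton.alpha D → X ^ σ ≤ Real.exp (3 * π) * X := by
  intro X
  obtain ⟨hD3, hDexp, hαpos, hαℓ, hℓinv, hαlogP, hlogP, -⟩ := param_facts hℓ4
  set ℓ := Skeleton.ell D with hℓdef
  have hℓ0 : 0 < ℓ := by linarith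
  have hℓ1 : 1 ≤ ℓ := by linarith
  obtain ⟨hPp, hp3⟩ := primeWindow_bounds hℓ1 hp
  have hP : Skeleton.bigP D = Real.exp (ℓ ^ 9) := rfl
  have hT : Skeleton.bigT D = Real.exp (ℓ ^ (1.1 : ℝ)) := rfl
  have hP0 : 0 < Skeleton.bigP D := Real.exp_pos _
  have hT1 : 1 ≤ Skeleton.bigT D := Real.one_le_exp (by positivity)
  have hT0 : 0 < Skeleton.bigT D := by linarith
  have hp0 : (0 : ℝ) < p := hP0.trans hPp
  have hk1 : (1 : ℝ) ≤ k := by exact_mod_cast hk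
  have hl1 : (1 : ℝ) ≤ l₂ := by exact_mod_cast hl₂
  have hd21 : (1 : ℝ) ≤ d₂ := by exact_mod_cast hd₂
  have hd11 : (1 : ℝ) ≤ d₁ := by exact_mod_cast hd₁
  have hX0 : 0 < X := by positivity
  -- `l₂ < P/T²`, `k < P/T² ≤ P`
  have hl₂T : (l₂ : ℝ) < Skeleton.bigP D / Skeleton.bigT D ^ 2 := by
    have : (l₂ : ℝ) ≤ ((d₂ * l₂ : ℕ) : ℝ) := by push_cast; nlinarith
    exact lt_of_le_of_lt this h1
  have hkP : (k : ℝ) ≤ Skeleton.bigP D := by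
    have hk' : (k : ℝ) ≤ ((d₁ * d₂ * k : ℕ) : ℝ) := by
      push_cast
      have : (1 : ℝ) ≤ (d₁ : ℝ) * d₂ := by nlinarith
      nlinarith
    have hPT : Skeleton.bigP D / Skeleton.bigT D ^ 2 ≤ Skeleton.bigP D :=
      div_le_self hP0.le (one_le_pow₀ hT1)
    linarith [lt_of_le_of_lt hk' h2]
  -- `T² < X`
  have hT2X : Skeleton.bigT D ^ 2 < X := by
    have hT20 : 0 < Skeleton.bigT D ^ 2 := by positivity
    have hl₂' : (l₂ : ℝ) * Skeleton.bigT D ^ 2 < Skeleton.bigP D := by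
      rwa [lt_div_iff₀ hT20] at hl₂T
    rw [show X = (p : ℝ) * k / l₂ from rfl, lt_div_iff₀ (by positivity)]
    calc Skeleton.bigT D ^ 2 * l₂ < Skeleton.bigP D := by linarith
      _ ≤ p := hPp.le
      _ ≤ p * k := le_mul_of_one_le_right hp0.le hk1
  have hX1 : 1 ≤ X := le_trans (one_le_pow₀ hT1) hT2X.le
  -- `X ≤ P³`
  have hP3 : (3 : ℝ) ≤ Skeleton.bigP D := by
    rw [hP]
    have h9 : (4 : ℝ) ≤ ℓ ^ 9 := by
      calc (4 : ℝ) ≤ 4 ^ 9 := by norm_num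
        _ ≤ ℓ ^ 9 := by gcongr
    have := Real.add_one_le_exp (ℓ ^ 9); linarith
  have hXP3 : X ≤ Skeleton.bigP D ^ 3 := by
    rw [show X = (p : ℝ) * k / l₂ from rfl, div_le_iff₀ (by positivity)]
    calc (p : ℝ) * k ≤ (3 * Skeleton.bigP D) * Skeleton.bigP D := by gcongr
      _ ≤ Skeleton.bigP D * Skeleton.bigP D * Skeleton.bigP D := by gcongr
      _ = Skeleton.bigP D ^ 3 * 1 := by ring
      _ ≤ Skeleton.bigP D ^ 3 * l₂ := by gcongr
  refine ⟨hX0, hX1, by rw [show X = (p : ℝ) * k / l₂ from rfl, inv_div], ?_, ?_⟩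
  · -- `X^{1−ℓ⁻¹} = X·X^{−ℓ⁻¹} ≤ X·(T²)^{−ℓ⁻¹} = X·exp(−2ℓ^{1/10})`
    rw [Real.rpow_sub hX0, Real.rpow_one, div_eq_mul_inv, ← Real.rpow_neg hX0.le]
    refine mul_le_mul_of_nonneg_left ?_ hX0.le
    have hneg : -ℓ⁻¹ ≤ 0 := by rw [neg_nonpos]; positivity
    calc X ^ (-ℓ⁻¹) ≤ (Skeleton.bigT D ^ 2) ^ (-ℓ⁻¹) :=
          Real.rpow_le_rpow_of_nonpos (by positivity) hT2X.le hneg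
      _ = Real.exp (-(2 * ℓ ^ ((1 : ℝ) / 10))) := by
          rw [hT, ← Real.exp_nat_mul, ← Real.exp_mul]
          congr 1
          have h11 : ℓ ^ (1.1 : ℝ) = ℓ * ℓ ^ ((1 : ℝ) / 10) := by
            rw [show (1.1 : ℝ) = 1 + 1 / 10 by norm_num, Real.rpow_add hℓ0, Real.rpow_one]
          rw [h11]; field_simp; ring
  · intro σ hσ
    -- `X^σ ≤ X^{1+α} = X·exp(α log X) ≤ X·exp(3α log P) = e^{3π}X`
    have hlogX : Real.log X ≤ 3 * Real.log (Skeleton.bigP D) := by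
      have h := Real.log_le_log hX0 hXP3
      rw [Real.log_pow, Nat.cast_ofNat] at h
      exact h
    have hlogX0 : 0 ≤ Real.log X := Real.log_nonneg hX1
    calc X ^ σ ≤ X ^ (1 + Skeleton.alpha D) := Real.rpow_le_rpow_of_exponent_le hX1 hσ
      _ = X * X ^ Skeleton.alpha D := by rw [Real.rpow_add hX0, Real.rpow_one]
      _ = X * Real.exp (Skeleton.alpha D * Real.log X) := by
          rw [Real.rpow_def_of_pos hX0, mul_comm (Real.log X)]
      _ ≤ X * Real.exp (3 * π) := by
          refine mul_le_mul_of_nonneg_left (Real.exp_le_exp.mpr ?_) hX0.le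
          calc Skeleton.alpha D * Real.log X ≤ Skeleton.alpha D * (3 * Real.log (Skeleton.bigP D)) :=
                mul_le_mul_of_nonneg_left hlogX hαpos.le
            _ = 3 * π := by rw [← hαlogP]; ring
      _ = Real.exp (3 * π) * X := mul_comm _ _


/-! ### §5. From pointwise bounds on the pieces to a bound for `contour719` (any integrand) -/

/-- Real and imaginary parts of the points of the contour. [folklore] -/
private theorem re_im_points (a t σ : ℝ) (D : ℕ) :
    ((1 : ℂ) + (a : ℂ) + (t : ℂ) * I).re = 1 + a ∧ ((1 : ℂ) + (a : ℂ) + (t : ℂ) * I).im = t ∧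
    ((1 : ℂ) - (a : ℂ) + (t : ℂ) * I).re = 1 - a ∧ ((1 : ℂ) - (a : ℂ) + (t : ℂ) * I).im = t ∧
    ((σ : ℂ) + (D : ℂ) * I).re = σ ∧ ((σ : ℂ) + (D : ℂ) * I).im = D ∧
    ((σ : ℂ) - (D : ℂ) * I).re = σ ∧ ((σ : ℂ) - (D : ℂ) * I).im = -D := by
  refine ⟨by simp, by simp, by simp, by simp, by simp, by simp, by simp, by simp⟩

/-- **Far vertical pieces** `s = 1 + a ± it`, `t > D`: a bound `K|t|⁻²` integrates to `K/D ≤ KE`.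
[cite: Zhang2022LandauSiegel, §7 p.40, tex L2109] -/
private theorem far_pieces_le {F : ℂ → ℂ} {a K D E : ℝ} (hD : 0 < D) (hK : 0 ≤ K)
    (hE : 1 / D ≤ E)
    (h : ∀ s : ℂ, s.re = 1 + a → D < |s.im| → ‖F s‖ ≤ K * |s.im| ^ (-2 : ℝ)) :
    ‖∫ t in Iic (-D), F (1 + (a : ℂ) + t * I)‖ ≤ K * E ∧
      ‖∫ t in Ici D, F (1 + (a : ℂ) + t * I)‖ ≤ K * E := by
  have hpt : ∀ t ∈ Ioi D, ∀ u : ℝ, |u| = t → ‖F (1 + (a : ℂ) + u * I)‖ ≤ K * t ^ (-2 : ℝ) := by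
    intro t ht u hu
    have ht : D < t := ht
    obtain ⟨hre, him, -⟩ := re_im_points a u 0 0
    have := h _ hre (by rw [him, hu]; exact ht)
    rwa [him, hu] at this
  have hKD : K / D ≤ K * E := by
    rw [div_eq_mul_one_div]; exact mul_le_mul_of_nonneg_left hE hK
  constructor
  · have hsub := integral_comp_neg_Ioi D (fun t : ℝ => F (1 + (a : ℂ) + t * I))
    rw [← hsub]
    refine (norm_integral_Ioi_le hD fun t ht => hpt t ht (-t) ?_).trans hKD
    rw [abs_neg, abs_of_pos (hD.trans ht)]
  · rw [integral_Ici_eq_integral_Ioi]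
    refine (norm_integral_Ioi_le hD fun t ht => hpt t ht t ?_).trans hKD
    rw [abs_of_pos (hD.trans ht)]

/-- **Near vertical piece** `s = 1 − σ₀ + it`, `|t| ≤ D`: a Lorentzian bound integrates to `≤ Kπ`.
[cite: Zhang2022LandauSiegel, §7 p.40, tex L2109] -/
private theorem near_piece_le {F : ℂ → ℂ} {σ₀ K D : ℝ} (hK : 0 ≤ K)
    (h : ∀ s : ℂ, s.re = 1 - σ₀ → |s.im| ≤ D → ‖F s‖ ≤ K * (1 + s.im ^ 2)⁻¹) :
    ‖∫ t in Icc (-D) D, F (1 - (σ₀ : ℂ) + t * I)‖ ≤ K * π := by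
  refine norm_integral_Icc_le hK fun t ht => ?_
  obtain ⟨-, -, hre, him, -⟩ := re_im_points σ₀ t 0 0
  have := h _ hre (by rw [him]; exact abs_le.mpr ⟨ht.1, ht.2⟩)
  rwa [him] at this

/-- **Horizontal pieces** `s = σ ± iD`, `a ≤ σ ≤ b`, `b − a ≤ 1`: a constant bound `K` integrates
to `≤ K`. [cite: Zhang2022LandauSiegel, §7 p.40, tex L2115] -/
private theorem horiz_pieces_le {F : ℂ → ℂ} {a b K : ℝ} {D : ℕ} (hD : 0 < (D : ℝ)) (hab : a ≤ b)
    (hK : 0 ≤ K) (hlen : b - a ≤ 1)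
    (h : ∀ s : ℂ, a ≤ s.re → s.re ≤ b → |s.im| = D → ‖F s‖ ≤ K) :
    ‖∫ σ in a..b, F (σ + D * I)‖ ≤ K ∧ ‖∫ σ in a..b, F (σ - D * I)‖ ≤ K := by
  have hlen' : |b - a| ≤ 1 := by rw [abs_of_nonneg (by linarith)]; exact hlen
  have hfin : K * |b - a| ≤ K := by
    calc K * |b - a| ≤ K * 1 := mul_le_mul_of_nonneg_left hlen' hK
      _ = K := mul_one K
  constructor
  · refine (intervalIntegral.norm_integral_le_of_norm_le_const fun σ hσ => ?_).trans hfin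
    rw [Set.uIoc_of_le hab] at hσ
    obtain ⟨-, -, -, -, hre, him, -⟩ := re_im_points 0 0 σ D
    exact h _ (by rw [hre]; exact hσ.1.le) (by rw [hre]; exact hσ.2) (by rw [him, abs_of_pos hD])
  · refine (intervalIntegral.norm_integral_le_of_norm_le_const fun σ hσ => ?_).trans hfin
    rw [Set.uIoc_of_le hab] at hσ
    obtain ⟨-, -, -, -, -, -, hre, him⟩ := re_im_points 0 0 σ D
    exact h _ (by rw [hre]; exact hσ.1.le) (by rw [hre]; exact hσ.2)
      (by rw [him, abs_neg, abs_of_pos hD])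

/-- **The contour from its five pieces**: `‖(1/2πi)∫_𝒞 F‖ ≤ 2B₁ + B₂ + 2B₃` from bounds `B₁`
(far vertical), `B₂` (near vertical), `B₃` (horizontal), since `|1/2π|, |1/2πi| ≤ 1`.
[cite: Zhang2022LandauSiegel, §7 p.40, tex L2108–L2117] -/
private theorem contour_le {F : ℂ → ℂ} {D : ℕ} {B₁ B₂ B₃ : ℝ}
    (h1 : ‖∫ t in Iic (-(D : ℝ)), F (1 + Skeleton.alpha D + t * I)‖ ≤ B₁)
    (h2 : ‖∫ t in Ici (D : ℝ), F (1 + Skeleton.alpha D + t * I)‖ ≤ B₁)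
    (h3 : ‖∫ t in Icc (-(D : ℝ)) D, F (1 - (Skeleton.ell D)⁻¹ + t * I)‖ ≤ B₂)
    (h4 : ‖∫ σ in (1 - (Skeleton.ell D)⁻¹)..(1 + Skeleton.alpha D), F (σ + D * I)‖ ≤ B₃)
    (h5 : ‖∫ σ in (1 - (Skeleton.ell D)⁻¹)..(1 + Skeleton.alpha D), F (σ - D * I)‖ ≤ B₃) :
    ‖Section7dStatements.contour719 D F‖ ≤ 2 * B₁ + B₂ + 2 * B₃ := by
  obtain ⟨hc1, hc2⟩ := norm_consts_le_one
  have hvert : ‖Section7dStatements.vert747 D F‖ ≤ B₁ + B₁ + B₂ := by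
    unfold Section7dStatements.vert747
    rw [norm_mul]
    calc _ ≤ 1 * (‖∫ t in Iic (-(D : ℝ)), F (1 + Skeleton.alpha D + t * I)‖ +
          ‖∫ t in Ici (D : ℝ), F (1 + Skeleton.alpha D + t * I)‖ +
          ‖∫ t in Icc (-(D : ℝ)) D, F (1 - (Skeleton.ell D)⁻¹ + t * I)‖) :=
          mul_le_mul hc1 (norm_add₃_le) (norm_nonneg _) zero_le_one
      _ ≤ 1 * (B₁ + B₁ + B₂) := by gcongr
      _ = B₁ + B₁ + B₂ := one_mul _
  have hhoriz : ‖Section7dStatements.horiz748 D F‖ ≤ B₃ + B₃ := by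
    unfold Section7dStatements.horiz748
    rw [norm_mul]
    calc _ ≤ 1 * (‖∫ σ in (1 - (Skeleton.ell D)⁻¹)..(1 + Skeleton.alpha D), F (σ + D * I)‖ +
          ‖∫ σ in (1 - (Skeleton.ell D)⁻¹)..(1 + Skeleton.alpha D), F (σ - D * I)‖) :=
          mul_le_mul hc2 (norm_sub_le _ _) (norm_nonneg _) zero_le_one
      _ ≤ 1 * (B₃ + B₃) := by gcongr
      _ = B₃ + B₃ := one_mul _
  calc ‖Section7dStatements.contour719 D F‖
      = ‖Section7dStatements.vert747 D F + Section7dStatements.horiz748 D F‖ := rfl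
    _ ≤ ‖Section7dStatements.vert747 D F‖ + ‖Section7dStatements.horiz748 D F‖ := norm_add_le _ _
    _ ≤ 2 * B₁ + B₂ + 2 * B₃ := by linarith

/-! ### §6. `ContourW[G₀]` and the closure of (7.10) -/

set_option maxHeartbeats 400000 in
/-- **`ContourW[G₀]` — the "standard estimates" bound of `Z22:§7.u049` for the integral over the
shifted contour of (7.19), with the derivable weight `G₀ = τ₅(d₁)∏_{q∣d₁d₂k}(1 + 200q^{−9/10})²**
(gap row G-d24-1; the binder is VERBATIM the hypothesis `hbound` of
`Section7dStatements.eq710_of_contourBoundG0`): under (A), for `D` large, `p ∼ P`,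
`d₂l₂ < PT⁻²`, `d₁d₂k < PT⁻²`,
`‖(1/2πi)∫_𝒞 (l₂/pk)^{−s} κ̃(d₁;d₂k,s)λ(d₁d₂k,s)ζ(s+β₁)ζ(s+β₂)ζ(s+β₃)ζ(s)⁻¹δ(s) ds‖ ≤ C·G₀·pkε₁/l₂`
with `ε₁ = exp(−c𝓛^{1/10})`, here `c = 1/2`, `C = 1`. Proof = the three piece estimates of
§7 p. 40: on `σ = 1 + α`, `|t| ≥ D`: `ζ, ζ⁻¹ ≤ 1 + α⁻¹ ≤ 𝓛⁹`, `(pk/l₂)^{1+α} ≤ e^{3π}pk/l₂`,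
`δ ≪ 𝓛ᵏ t⁻²`, `∫_{|t|≥D} t⁻² = 2/D`; on `σ = 1 − 𝓛⁻¹`, `|t| ≤ D`: `ζ(s+β_j) ≪ 𝓛`
(Titchmarsh 3.5 / the pole), `ζ⁻¹ ≪ 𝓛⁹` (`ZetaLowerBound.norm_inv_zeta_le_pow_nine`, under (A)),
`δ ≪ 𝓛ᵏ(1+t²)⁻¹`, and the saving `(pk/l₂)^{−𝓛⁻¹} ≤ T^{−2/𝓛} = exp(−2𝓛^{1/10})` (`pk/l₂ > T²`);
on `σ ± iD`: the same factors with `δ ≪ 𝓛ᵏD⁻²`; `κ̃λ ≤ G₀` throughout (`Z22:§7.u046`); the powers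
of `𝓛` are absorbed by halving the constant of `ε₁` (`absorb_pow_log_eps1`).
[cite: Zhang2022LandauSiegel, §7 p.40, tex L2108–L2127] -/
theorem contourBoundG0 (c' : ℝ) :
    ∃ c : ℝ, 0 < c ∧ ∃ C : ℝ, Skeleton.ForAllLarge fun D _ χ =>
      Skeleton.AssumptionA D χ → ∀ p ∈ Skeleton.primeWindow D, ∀ d₁ d₂ k l₂ : ℕ,
        0 < d₁ → 0 < d₂ → 0 < k → 0 < l₂ →
        ((d₂ * l₂ : ℕ) : ℝ) < Skeleton.bigP D / Skeleton.bigT D ^ 2 →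
        ((d₁ * d₂ * k : ℕ) : ℝ) < Skeleton.bigP D / Skeleton.bigT D ^ 2 →
          ‖Section7dStatements.contour719 D (fun s =>
              (((l₂ : ℝ) / ((p : ℝ) * k) : ℝ) : ℂ) ^ (-s) *
                (Skeleton.kappaTilde c' D d₁ (d₂ * k) s * Skeleton.lam c' D (d₁ * d₂ * k) s *
                  Section7dStatements.resFn c' D s))‖ ≤
            C * ((Section7dStatements.tauFive d₁ : ℝ) * ∏ q ∈ (d₁ * d₂ * k).primeFactors,
                (1 + 200 / (q : ℝ) ^ (9 / 10 : ℝ)) ^ 2) *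
              ((p : ℝ) * k * Section7dStatements.eps1 c D / l₂) := by
  -- the constants
  obtain ⟨kδ, Cδ, D₅₄, h54⟩ := Skeleton.lemma54_holds
  obtain ⟨C₉, hC₉, D₉, h9⟩ := ZetaLowerBound.norm_inv_zeta_le_pow_nine
  obtain ⟨M, hM0, hM⟩ := ZetaNearOne.exists_bound_riemannZeta_rect
  set Cδ' : ℝ := max Cδ 1 with hCδ'
  have hCδ'0 : 0 ≤ Cδ' := le_trans zero_le_one (le_max_right _ _)
  set Z₁ : ℝ := 16 * Real.exp 2 + M + 1 with hZ₁
  have hZ₁0 : 0 ≤ Z₁ := by rw [hZ₁]; positivity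
  set N : ℕ := 36 + kδ with hN
  set A : ℝ := 2 * (Real.exp (3 * π) * Cδ') + π * (4 * Z₁ ^ 3 * C₉ * Cδ') +
    2 * (Real.exp (3 * π) * Z₁ ^ 3 * C₉ * Cδ') with hA
  obtain ⟨Dabs, habs⟩ := Section7dStatements.absorb_pow_log_eps1 A N 1 one_pos
  obtain ⟨Dℓ, hDℓ⟩ := exists_nat_ell_ge (12 + 80 * |c'|)
  refine ⟨1 / 2, by norm_num, 1, max (max D₅₄ D₉) (max Dabs Dℓ), ?_⟩
  intro D _ χ hD hq hprim hA' p hp d₁ d₂ k l₂ hd₁ hd₂ hk hl₂ h1 h2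
  have hD54 : D₅₄ ≤ D := le_trans (le_trans (le_max_left _ _) (le_max_left _ _)) hD
  have hD9 : D₉ ≤ D := le_trans (le_trans (le_max_right _ _) (le_max_left _ _)) hD
  have hDabs : Dabs ≤ D := le_trans (le_trans (le_max_left _ _) (le_max_right _ _)) hD
  have hDℓ' : Dℓ ≤ D := le_trans (le_trans (le_max_right _ _) (le_max_right _ _)) hD
  obtain ⟨hℓc, hℓ4⟩ := hDℓ D hDℓ'
  obtain ⟨hD3, hDexp, hαpos, hαℓ, hℓinv, hαlogP, hlogP, hinvα⟩ := param_facts hℓ4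
  obtain ⟨hb1re, hb2re, hb3re⟩ := beta_re c' D
  obtain ⟨hb1im, hb2im, hb3im⟩ := beta_im_le c' hℓ4 hℓc
  obtain ⟨hX0, hX1, hxX, hXnear, hXfar⟩ := X_facts hℓ4 hp hd₁ hd₂ hk hl₂ h1 h2
  set X : ℝ := (p : ℝ) * k / l₂ with hXdef
  set ℓ : ℝ := Skeleton.ell D with hℓdef
  set α : ℝ := Skeleton.alpha D with hαdef
  set G : ℝ := (Section7dStatements.tauFive d₁ : ℝ) * ∏ q ∈ (d₁ * d₂ * k).primeFactors,
    (1 + 200 / (q : ℝ) ^ (9 / 10 : ℝ)) ^ 2 with hGdef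
  set E₁ : ℝ := Section7dStatements.eps1 1 D with hE₁
  set F : ℂ → ℂ := fun s => (((l₂ : ℝ) / ((p : ℝ) * k) : ℝ) : ℂ) ^ (-s) *
    (Skeleton.kappaTilde c' D d₁ (d₂ * k) s * Skeleton.lam c' D (d₁ * d₂ * k) s *
      Section7dStatements.resFn c' D s) with hF
  have hℓ0 : 0 < ℓ := by linarith
  have hℓ1 : 1 ≤ ℓ := by linarith
  have hℓinv12 : ℓ⁻¹ ≤ 1 / 12 := by
    rw [inv_eq_one_div]
    exact one_div_le_one_div_of_le (by norm_num) (by linarith [abs_nonneg c'])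
  have hℓinv0 : 0 < ℓ⁻¹ := inv_pos.mpr hℓ0
  have hα4 : α ≤ 1 / 4 := hαℓ.trans hℓinv
  have hD0 : (0 : ℝ) < D := by linarith
  have hD1 : (1 : ℝ) ≤ D := by linarith
  have hDinv1 : (D : ℝ)⁻¹ ≤ 1 := inv_le_one_of_one_le₀ hD1
  have hG0 : 0 ≤ G := by rw [hGdef]; positivity
  have hE₁0 : 0 ≤ E₁ := (Real.exp_pos _).le
  have hdvd : d₁ ∣ d₁ * d₂ * k := Dvd.intro (d₂ * k) (by ring)
  have hn0 : d₁ * d₂ * k ≠ 0 := (Nat.mul_pos (Nat.mul_pos hd₁ hd₂) hk).ne'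
  have hd₁0 : d₁ ≠ 0 := hd₁.ne'
  have hpowN : ℓ ^ (12 + kδ) ≤ ℓ ^ N := pow_le_pow_right₀ hℓ1 (by rw [hN]; omega)
  -- `δ`, `ζ⁻¹` at this `D`
  have hδ : ∀ s : ℂ, 1 / 2 ≤ s.re → s.re ≤ 2 →
      ‖Skeleton.deltaW D s‖ ≤ Cδ' * ℓ ^ kδ * ‖s‖⁻¹ ^ 2 := by
    intro s hs1 hs2
    refine ((h54 D χ hD54 hq hprim s).1 hs1 hs2).trans ?_
    have : 0 ≤ ℓ ^ kδ * ‖s‖⁻¹ ^ 2 := by positivity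
    calc Cδ * Skeleton.ell D ^ kδ * ‖s‖⁻¹ ^ 2 = Cδ * (ℓ ^ kδ * ‖s‖⁻¹ ^ 2) := by rw [hℓdef]; ring
      _ ≤ Cδ' * (ℓ ^ kδ * ‖s‖⁻¹ ^ 2) := mul_le_mul_of_nonneg_right (le_max_left _ _) this
      _ = Cδ' * ℓ ^ kδ * ‖s‖⁻¹ ^ 2 := by ring
  have h9D := h9 D χ hD9 hq hprim hA'
  -- the savings in terms of `E₁ = exp(−𝓛^{1/10})`
  have hE₁near : Real.exp (-(2 * ℓ ^ ((1 : ℝ) / 10))) ≤ E₁ := by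
    rw [hE₁, Section7dStatements.eps1]
    apply Real.exp_le_exp.mpr
    have : 0 ≤ Skeleton.ell D ^ ((1 : ℝ) / 10) := by positivity
    rw [← hℓdef] at this ⊢
    linarith
  have hE₁D : 1 / (D : ℝ) ≤ E₁ := by
    rw [hE₁, Section7dStatements.eps1, hDexp, one_div, ← Real.exp_neg, ← hℓdef]
    apply Real.exp_le_exp.mpr
    have : ℓ ^ ((1 : ℝ) / 10) ≤ ℓ := by
      calc ℓ ^ ((1 : ℝ) / 10) ≤ ℓ ^ (1 : ℝ) := Real.rpow_le_rpow_of_exponent_le hℓ1 (by norm_num)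
        _ = ℓ := Real.rpow_one ℓ
    linarith
  ------------------------------------------------------------------
  -- FAR vertical pieces: `s = 1 + α ± it`, `t > D`
  ------------------------------------------------------------------
  set Kfar : ℝ := Real.exp (3 * π) * Cδ' * G * X * ℓ ^ N with hKfar
  have hKfar0 : 0 ≤ Kfar := by rw [hKfar]; positivity
  have hfar : ∀ s : ℂ, s.re = 1 + α → (D : ℝ) < |s.im| →
      ‖F s‖ ≤ Kfar * |s.im| ^ (-2 : ℝ) := by
    intro s hre him
    have him0 : 0 < |s.im| := lt_trans hD0 him
    have hσ : 9 / 10 < s.re := by rw [hre]; linarith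
    have hZ : ∀ β : ℂ, β.re = 0 → ‖riemannZeta (s + β)‖ ≤ ℓ ^ 9 := fun β hβ =>
      (ZetaNearOne.norm_riemannZeta_le_of_re hαpos
        (by rw [Complex.add_re, hβ, hre, add_zero])).trans hinvα
    have hZi : ‖(riemannZeta s)⁻¹‖ ≤ ℓ ^ 9 :=
      (ZetaNearOne.norm_inv_riemannZeta_le_of_re hαpos hre.ge).trans hinvα
    have hδs : ‖Skeleton.deltaW D s‖ ≤ Cδ' * ℓ ^ kδ * |s.im| ^ (-2 : ℝ) := by
      refine (hδ s (by rw [hre]; linarith) (by rw [hre]; linarith)).trans ?_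
      have hcmp : ‖s‖⁻¹ ^ 2 ≤ |s.im| ^ (-2 : ℝ) := by
        rw [Real.rpow_neg him0.le, show (2 : ℝ) = ((2 : ℕ) : ℝ) by norm_num, Real.rpow_natCast,
          ← inv_pow]
        have h1 : ‖s‖⁻¹ ≤ |s.im|⁻¹ := inv_anti₀ him0 (Complex.abs_im_le_norm s)
        exact pow_le_pow_left₀ (by positivity) h1 2
      exact mul_le_mul_of_nonneg_left hcmp (by positivity)
    have hBx : X ^ s.re ≤ Real.exp (3 * π) * X := hXfar s.re hre.le
    have key := norm_integrand_le c' D (m := d₂ * k) hd₁0 hdvd hn0 hX0 hxX hσ (by positivity)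
      hBx (hZ _ hb1re) (hZ _ hb2re) (hZ _ hb3re) hZi hδs
    calc ‖F s‖ = _ := by rw [hF]
      _ ≤ _ := key
      _ = Kfar * |s.im| ^ (-2 : ℝ) := by rw [hKfar, hN, pow_add, hGdef]; ring
  obtain ⟨hfar_minus, hfar_plus⟩ := far_pieces_le (F := F) hD0 hKfar0 hE₁D hfar
  ------------------------------------------------------------------
  -- NEAR vertical piece: `s = 1 − 𝓛⁻¹ + it`, `|t| ≤ D`
  ------------------------------------------------------------------
  set Knear : ℝ := 4 * Z₁ ^ 3 * C₉ * Cδ' * G * X * ℓ ^ N with hKnear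
  have hKnear0 : 0 ≤ Knear * E₁ := by rw [hKnear]; positivity
  have hnear_pt : ∀ s : ℂ, s.re = 1 - ℓ⁻¹ → |s.im| ≤ D →
      ‖F s‖ ≤ Knear * E₁ * (1 + s.im ^ 2)⁻¹ := by
    intro s hre him
    have hσ : 9 / 10 < s.re := by rw [hre]; linarith
    have hs1 : s ≠ 1 := fun h => by
      have := congrArg Complex.re h; rw [hre, Complex.one_re] at this; linarith
    have hZ : ∀ β : ℂ, β.re = 0 → |β.im| ≤ 1 → ‖riemannZeta (s + β)‖ ≤ Z₁ * ℓ :=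
      fun β hβre hβim => norm_zeta_shift_le_near hℓ4 hDexp hM0 hM hre him hβre hβim
    have hZi : ‖(riemannZeta s)⁻¹‖ ≤ C₉ * ℓ ^ 9 :=
      h9D s hs1 (by rw [hre]) (by rw [hre]; linarith) him
    have hδs : ‖Skeleton.deltaW D s‖ ≤ Cδ' * ℓ ^ kδ * (4 * (1 + s.im ^ 2)⁻¹) := by
      refine (hδ s (by rw [hre]; linarith) (by rw [hre]; linarith)).trans ?_
      have hcmp : ‖s‖⁻¹ ^ 2 ≤ 4 * (1 + s.im ^ 2)⁻¹ := by
        have hre2 : 1 / 2 ≤ s.re := by rw [hre]; linarith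
        have h14 : 1 / 4 ≤ s.re * s.re := by
          have := mul_le_mul hre2 hre2 (by norm_num) (by linarith)
          linarith
        have hns : (1 + s.im ^ 2) / 4 ≤ ‖s‖ ^ 2 := by
          rw [Complex.sq_norm, Complex.normSq_apply]
          have : s.im ^ 2 = s.im * s.im := sq _
          linarith [mul_self_nonneg s.im]
        have hpos : 0 < (1 + s.im ^ 2) / 4 := by positivity
        rw [inv_pow]
        calc (‖s‖ ^ 2)⁻¹ ≤ ((1 + s.im ^ 2) / 4)⁻¹ := inv_anti₀ hpos hns
          _ = 4 * (1 + s.im ^ 2)⁻¹ := by rw [inv_div, div_eq_mul_inv, mul_comm]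
      exact mul_le_mul_of_nonneg_left hcmp (by positivity)
    have hBx : X ^ s.re ≤ X * E₁ := by
      rw [hre]
      exact hXnear.trans (mul_le_mul_of_nonneg_left hE₁near hX0.le)
    have key := norm_integrand_le c' D (m := d₂ * k) hd₁0 hdvd hn0 hX0 hxX hσ (by positivity)
      hBx (hZ _ hb1re hb1im) (hZ _ hb2re hb2im) (hZ _ hb3re hb3im) hZi hδs
    have hrest : 0 ≤ 4 * Z₁ ^ 3 * C₉ * Cδ' * G * X * E₁ * (1 + s.im ^ 2)⁻¹ := by positivity
    calc ‖F s‖ = _ := by rw [hF]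
      _ ≤ _ := key
      _ = (4 * Z₁ ^ 3 * C₉ * Cδ' * G * X * E₁ * (1 + s.im ^ 2)⁻¹) * ℓ ^ (12 + kδ) := by
          rw [pow_add, hGdef]; ring
      _ ≤ (4 * Z₁ ^ 3 * C₉ * Cδ' * G * X * E₁ * (1 + s.im ^ 2)⁻¹) * ℓ ^ N :=
          mul_le_mul_of_nonneg_left hpowN hrest
      _ = Knear * E₁ * (1 + s.im ^ 2)⁻¹ := by rw [hKnear]; ring
  have hnear := near_piece_le (F := F) (σ₀ := ℓ⁻¹) hKnear0 hnear_pt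
  ------------------------------------------------------------------
  -- HORIZONTAL pieces: `s = σ ± iD`, `1 − 𝓛⁻¹ ≤ σ ≤ 1 + α`
  ------------------------------------------------------------------
  set Kh : ℝ := Real.exp (3 * π) * Z₁ ^ 3 * C₉ * Cδ' * G * X * ℓ ^ N with hKh
  have hKh0 : 0 ≤ Kh * E₁ := by rw [hKh]; positivity
  have hh_pt : ∀ s : ℂ, 1 - ℓ⁻¹ ≤ s.re → s.re ≤ 1 + α → |s.im| = D → ‖F s‖ ≤ Kh * E₁ := by
    intro s hre1 hre2 him
    have hσ : 9 / 10 < s.re := by linarith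
    have hs1 : s ≠ 1 := fun h => by
      have := congrArg Complex.im h
      rw [Complex.one_im] at this
      rw [this, abs_zero] at him
      linarith
    have hZ : ∀ β : ℂ, β.re = 0 → |β.im| ≤ 1 → ‖riemannZeta (s + β)‖ ≤ Z₁ * ℓ := by
      intro β hβre hβim
      refine (norm_zeta_shift_le_horiz hℓ4 hDexp hre1 him hβre hβim).trans ?_
      have : 16 * Real.exp 2 ≤ Z₁ := by rw [hZ₁]; linarith
      exact mul_le_mul_of_nonneg_right this hℓ0.le
    have hZi : ‖(riemannZeta s)⁻¹‖ ≤ C₉ * ℓ ^ 9 :=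
      h9D s hs1 hre1 (by linarith) him.le
    have hδs : ‖Skeleton.deltaW D s‖ ≤ Cδ' * ℓ ^ kδ * E₁ := by
      refine (hδ s (by linarith) (by linarith)).trans ?_
      have hcmp : ‖s‖⁻¹ ^ 2 ≤ E₁ := by
        have hDs : (D : ℝ) ≤ ‖s‖ := by rw [← him]; exact Complex.abs_im_le_norm s
        have h1 : ‖s‖⁻¹ ≤ (D : ℝ)⁻¹ := inv_anti₀ hD0 hDs
        calc ‖s‖⁻¹ ^ 2 ≤ (D : ℝ)⁻¹ ^ 2 := pow_le_pow_left₀ (by positivity) h1 2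
          _ = (D : ℝ)⁻¹ * (D : ℝ)⁻¹ := sq _
          _ ≤ (D : ℝ)⁻¹ * 1 := mul_le_mul_of_nonneg_left hDinv1 (by positivity)
          _ = 1 / D := by rw [mul_one, one_div]
          _ ≤ E₁ := hE₁D
      exact mul_le_mul_of_nonneg_left hcmp (by positivity)
    have hBx : X ^ s.re ≤ Real.exp (3 * π) * X := hXfar s.re hre2
    have key := norm_integrand_le c' D (m := d₂ * k) hd₁0 hdvd hn0 hX0 hxX hσ (by positivity)
      hBx (hZ _ hb1re hb1im) (hZ _ hb2re hb2im) (hZ _ hb3re hb3im) hZi hδs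
    have hrest : 0 ≤ Real.exp (3 * π) * Z₁ ^ 3 * C₉ * Cδ' * G * X * E₁ := by positivity
    calc ‖F s‖ = _ := by rw [hF]
      _ ≤ _ := key
      _ = (Real.exp (3 * π) * Z₁ ^ 3 * C₉ * Cδ' * G * X * E₁) * ℓ ^ (12 + kδ) := by
          rw [pow_add, hGdef]; ring
      _ ≤ (Real.exp (3 * π) * Z₁ ^ 3 * C₉ * Cδ' * G * X * E₁) * ℓ ^ N :=
          mul_le_mul_of_nonneg_left hpowN hrest
      _ = Kh * E₁ := by rw [hKh]; ring
  obtain ⟨hh_plus, hh_minus⟩ := horiz_pieces_le (F := F) (D := D) hD0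
    (by linarith : 1 - ℓ⁻¹ ≤ 1 + α) hKh0 (by linarith) hh_pt
  ------------------------------------------------------------------
  -- assembly
  ------------------------------------------------------------------
  have htot := contour_le (F := F) hfar_minus hfar_plus hnear hh_plus hh_minus
  have habs' : A * ℓ ^ N * E₁ ≤ Section7dStatements.eps1 (1 / 2) D := habs D hDabs
  have hGX : 0 ≤ G * X := by positivity
  calc ‖Section7dStatements.contour719 D F‖
      ≤ 2 * (Kfar * E₁) + Knear * E₁ * π + 2 * (Kh * E₁) := htot
    _ = G * X * (A * ℓ ^ N * E₁) := by rw [hKfar, hKnear, hKh, hA]; ring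
    _ ≤ G * X * Section7dStatements.eps1 (1 / 2) D := mul_le_mul_of_nonneg_left habs' hGX
    _ = 1 * G * ((p : ℝ) * k * Section7dStatements.eps1 (1 / 2) D / l₂) := by
        rw [hXdef]; ring

/-- **(7.10) HOLDS** (cone leaf `h710` of the whole-DAG theorem; DAG node `Z22:(7.10)`, and with
it `Z22:§7.u049`, `Z22:§7.u052`, `Z22:(7.20)` in their derivable weighted reading, G-d24-1): the
closing composition `Section7dStatements.eq710_of_contourBoundG0` (every other displayed step of
§7 part (c) being a tree theorem) applied to `contourBoundG0`.
[cite: Zhang2022LandauSiegel, §7 (7.10) p.37, tex L1973; pp.39–42, tex L2063–L2178] -/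
theorem _root_.Literature.NumberTheory.LFunctions.Zhang2022.Section7dStatements.eq710_holds
    (c' : ℝ) : Section7bStatements.Eq710 c' :=
  Section7dStatements.eq710_of_contourBoundG0 c' (contourBoundG0 c')

variable (c' : ℝ) in
/-- `Eq710` — `_holds` alias of `eq710_holds` above under the fact's exact name, stated under the
prover's own binders as section variables (appended 2026-08-28, D-0026 bookkeeping: the proof term is the
existing theorem of this file; no statement, definition or attribute is edited; no new named fact; the
ledger's debt table listed the fact unproved). [cite: Zhang2022LandauSiegel, §7 (7.10) p.37, tex L1973; pp.39–42, tex L2063–L2178] -/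
theorem _root_.Literature.NumberTheory.LFunctions.Zhang2022.Section7bStatements.Eq710_holds :
    _root_.Literature.NumberTheory.LFunctions.Zhang2022.Section7bStatements.Eq710 c' :=
  _root_.Literature.NumberTheory.LFunctions.Zhang2022.Section7dStatements.eq710_holds (c' := c')

/-- **Proposition 7.1 from its part-(a)/(b) leaves** `(7.6)`, `(7.7)′`, `(7.11)` alone — the
part-(c) leaf (7.10) being discharged (`eq710_holds`).
[cite: Zhang2022LandauSiegel, §7 pp.32–42, tex L1786–L2178] -/
theorem _root_.Literature.NumberTheory.LFunctions.Zhang2022.Section7dStatements.prop71_of_leaves_ab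
    (c' : ℝ) (h76 : Section7bStatements.Eq76 c') (h1944 : Section7bStatements.Step7t1944 c')
    (h711 : Section7bStatements.Eq711 c') : Skeleton.Prop71 c' :=
  Section7bStatements.prop71_of_leaves c' h76 h1944 (Section7dStatements.eq710_holds c') h711

end Literature.NumberTheory.LFunctions.Zhang2022.ContourBound7
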